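/-
Copyright (c) 2026 The h413 squad. All rights reserved.
Released under Apache 2.0 license as described in the file LICENSE.
Authors: K2E3-p17 (g5) (road HC-14-ell, piece E3d∕E3e — kit)
-/
import Summits.HodgeConjecture.HodgeConjecture.Theorems.K2E3HC14EllLocalToUniform   -- ★ p857025∕p857038 (K2E3-p14 g3): frame, `conjAct_mul`, `mem_lieU_conjAct`, `charpoly_conjAct`
import Literature.LinearAlgebra.Matrix.CubicCharpolyDiscrNonRegular                   -- ★ `discr_smul_fin_three`, `charpoly_fin_three_trace_minors_det`, `discr_eq_of_charpoly_eq`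
import Literature.LinearAlgebra.Matrix.RegularSemisimpleConjClassClosed                -- ★ `continuous_charpoly_coeff`
import Literature.MeasureTheory.Group.LocalFieldGLnVolume                               -- ★ boxes `Mₙ(𝔭^k)`: `isOpen_∕isCompact_setOf_forall_mem_primePowBall`
import Literature.NumberTheory.Automorphic.AddCharConductorExponent                     -- ★ `primePowBall` API: `mul_mem_primePowBall_iff`, `exists_mem_primePowBall`, `primePowBall_antitone`
import HarnessLib

/-!
# K2_E3 road (h413), (SC-an) cone, road «HC-14-ell», piece E3d∕E3e — KIT for Harish-Chandra's stretching `X ↦ pX` on `𝔲(σ,J) ⊆ M₃(K)` ([HarishChandra1970] VI §1, §7)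

Cell `pub/hodgecm-mathlib`, crux H413 = `stmt-HodgeConjecture-24833` (supports-only, `--as helper`), Track B «K2-LIT» engine E3, leaf (SC-an) ⟸ letter «HC-14-ell»
⟸ (E5) its Lie twin «HC13-Lie-ell» (cand `sig_K2E3HC13LieEllRankOne`, (SC-an) lead K2E3-p14 (g3)).  This kit holds the elementary pieces used by the sibling file
`K2E3HC13LieZeroStretching` (HARISH-CHANDRA'S THEOREM 13 AT THE ORIGIN, [HarishChandra1970] Part VI §7) in the letter's own currency `gXg⁻¹ = ↑g * X * ↑(g⁻¹)`
(inverse in `GL₃(K)`), weight `|discr χ_X|_K^{1∕4}`: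

* §1 the three invariant coefficients of `χ_Y` on `M₃`, their homogeneity `coeff_d χ_{tY} = t^{3−d} coeff_d χ_Y`, `discr χ_{tY} = t⁶ discr χ_Y` (★ `discr_smul_fin_three`), and
  «`discr χ_Y ≠ 0 ⇒` some `coeff_d χ_Y ≠ 0`» (`d ≤ 2`);
* §2 the adjoint action: `χ_{gXg⁻¹} = χ_X`, `𝔲` is `Ad`-stable and stable under `σ`-fixed scalars, `g(tX)g⁻¹ = t·gXg⁻¹`, `{g | g(tX)g⁻¹ = tX} = {g | gXg⁻¹ = X}`;
* §3 the stretching scalar `p` = residue characteristic (`σ p = p` for every `σ`, `0 < |p|_K < 1` in characteristic `0`) and the open-compact boxes `M₃(𝔭^k)`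
  (`p • Y ∈ M₃(𝔭^k) ↔ Y ∈ M₃(𝔭^{k−e})` for `|p|_K = q^{−e}`; every compact set lies in a box);
* §4 the weight under stretching `|discr χ_{tX}|_K^{1∕4} = (|t|_K⁶)^{1∕4}|discr χ_X|_K^{1∕4}` (print: `|η(t⁻¹H)|^{1∕2} = |t|^{−(n−ℓ)∕2}|η(H)|^{1∕2}`, `n − ℓ = 6`),
  continuity∕measurability of `g ↦ Θ(gXg⁻¹)`;
* §5 FAR OUT (Cor. of Lemma 28 along the ray `p^{−m}X`): if `discr χ_X ≠ 0` then for `m ≫ 0` no `U`-conjugate of `p^{−m}X` lies in a given box (one coefficient of the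
  conjugation-invariant `χ` blows up, all are bounded on the compact box) — `exists_pow_smul_forall_conj_notMem_box`.

HONEST LABEL: `--supports stmt-HodgeConjecture-24833 --as helper`, count-neutral; HC_CM is proved only modulo the 7 printed citations (2 remaining named inputs:
hLiu418 = `stmt-HodgeConjecture-24832`, h413 = `stmt-HodgeConjecture-24833`) until rung 0 closes; nothing of (SC-an) is proved here.

## References
* [HarishChandra1970] Harish-Chandra (notes by G. van Dijk), *Harmonic Analysis on Reductive p-adic Groups*, LNM 162 (1970): Part VI §1 Lemma 28 and Corollary p. 48,
  §7 pp. 59–60; Part V §1 p. 40.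
* [Rogawski1990] J. D. Rogawski, *Automorphic Representations of Unitary Groups in Three Variables*, Ann. of Math. Stud. 123 (1990), §3.1 p. 19, §7.3 p. 97.
* [HornJohnson2013] R. A. Horn, C. R. Johnson, *Matrix Analysis*, 2nd ed. (2013), §1.2 Problem 1.2.P18.
* [Humphreys1972] J. E. Humphreys, *Introduction to Lie Algebras and Representation Theory*, GTM 9 (1972), §23.2.
* [WeilBNT1967] A. Weil, *Basic Number Theory* (1967), Ch. I §2.
-/

set_option autoImplicit false
set_option linter.dupNamespace false

noncomputable section

open MeasureTheory Measure Set Filter Topology Polynomial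
open scoped NNReal ENNReal MatrixGroups WithZero
open Literature.NumberTheory.Automorphic Literature.NumberTheory.Automorphic.UnitaryGroup
open Literature.NumberTheory.GaloisRepresentations Literature.NumberTheory.GaloisRepresentations.IsNonarchimedeanLocalField

namespace Summit.HodgeConjecture.HodgeConjecture.Cruxes.H413.K2E3HC13LieStretchingKit

/-! ## §1 Algebra on `M₃(K)`: the three coefficients of `χ_Y`, their homogeneity, and `discr χ_{tY} = t⁶ discr χ_Y` -/

section Algebra

variable {K : Type*} [Field K]

/-- `coeff₂ χ_Y = −tr Y`. [cite: HornJohnson2013, §1.2 Problem 1.2.P18] -/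
theorem charpoly_coeff_two (Y : Matrix (Fin 3) (Fin 3) K) : Y.charpoly.coeff 2 = -Y.trace := by
  rw [Literature.LinearAlgebra.Matrix.charpoly_fin_three_trace_minors_det]
  simp

/-- `coeff₁ χ_Y = e₂(Y)` (sum of the principal `2 × 2` minors). [cite: HornJohnson2013, §1.2 Problem 1.2.P18] -/
theorem charpoly_coeff_one (Y : Matrix (Fin 3) (Fin 3) K) : Y.charpoly.coeff 1 =
    (Y 0 0 * Y 1 1 - Y 0 1 * Y 1 0) + (Y 0 0 * Y 2 2 - Y 0 2 * Y 2 0) + (Y 1 1 * Y 2 2 - Y 1 2 * Y 2 1) := by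
  rw [Literature.LinearAlgebra.Matrix.charpoly_fin_three_trace_minors_det]
  simp

/-- `coeff₀ χ_Y = −det Y`. [cite: HornJohnson2013, §1.2 Problem 1.2.P18] -/
theorem charpoly_coeff_zero (Y : Matrix (Fin 3) (Fin 3) K) : Y.charpoly.coeff 0 = -Y.det := by
  rw [Literature.LinearAlgebra.Matrix.charpoly_fin_three_trace_minors_det]
  simp

/-- Homogeneity: `coeff₂ χ_{tY} = t · coeff₂ χ_Y`. [cite: Humphreys1972, §23.2] -/
theorem charpoly_coeff_two_smul (t : K) (Y : Matrix (Fin 3) (Fin 3) K) : (t • Y).charpoly.coeff 2 = t ^ 1 * Y.charpoly.coeff 2 := by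
  rw [charpoly_coeff_two, charpoly_coeff_two, Matrix.trace_smul, smul_eq_mul, pow_one, mul_neg]

/-- Homogeneity: `coeff₁ χ_{tY} = t² · coeff₁ χ_Y`. [cite: Humphreys1972, §23.2] -/
theorem charpoly_coeff_one_smul (t : K) (Y : Matrix (Fin 3) (Fin 3) K) : (t • Y).charpoly.coeff 1 = t ^ 2 * Y.charpoly.coeff 1 := by
  rw [charpoly_coeff_one, charpoly_coeff_one]
  simp only [Matrix.smul_apply, smul_eq_mul]
  ring

/-- Homogeneity: `coeff₀ χ_{tY} = t³ · coeff₀ χ_Y`. [cite: Humphreys1972, §23.2] -/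
theorem charpoly_coeff_zero_smul (t : K) (Y : Matrix (Fin 3) (Fin 3) K) : (t • Y).charpoly.coeff 0 = t ^ 3 * Y.charpoly.coeff 0 := by
  rw [charpoly_coeff_zero, charpoly_coeff_zero, Matrix.det_smul, Fintype.card_fin]
  ring

/-- `discr χ_{tY} = t⁶ · discr χ_Y` (★ `discr_smul_fin_three`, `Matrix.discr` unfolded). [cite: Humphreys1972, §23.2] -/
theorem charpoly_discr_smul (t : K) (Y : Matrix (Fin 3) (Fin 3) K) : (t • Y).charpoly.discr = t ^ 6 * Y.charpoly.discr :=
  Literature.LinearAlgebra.Matrix.discr_smul_fin_three t Y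

/-- A matrix all of whose non-leading characteristic coefficients vanish has `χ_Y = X³`, hence `discr χ_Y = 0` — so a matrix with
`discr χ_Y ≠ 0` has a non-zero coefficient `coeff_d χ_Y`, `d ∈ {0, 1, 2}`. [cite: HarishChandra1970, Part VI §1 Lemma 28 p. 48] -/
theorem exists_charpoly_coeff_ne_zero {Y : Matrix (Fin 3) (Fin 3) K} (hY : Y.charpoly.discr ≠ 0) :
    Y.charpoly.coeff 2 ≠ 0 ∨ Y.charpoly.coeff 1 ≠ 0 ∨ Y.charpoly.coeff 0 ≠ 0 := by
  by_contra h
  push Not at h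
  obtain ⟨h2, h1, h0⟩ := h
  apply hY
  have hform := Literature.LinearAlgebra.Matrix.discr_eq_of_charpoly_eq (Literature.LinearAlgebra.Matrix.charpoly_fin_three_trace_minors_det Y)
  rw [charpoly_coeff_two, neg_eq_zero] at h2
  rw [charpoly_coeff_one] at h1
  rw [charpoly_coeff_zero, neg_eq_zero] at h0
  rw [Matrix.discr] at hform
  rw [hform, h2, h1, h0]
  ring

end Algebra

/-! ## §2 The adjoint action in the letter's currency `g X g⁻¹ = ↑g * X * ↑(g⁻¹)` (inverse taken in `GL₃(K)`) -/

section Adjoint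

variable {K : Type*} [Field K] (σ : K →+* K) {J : Matrix (Fin 3) (Fin 3) K}

/-- `χ_{gXg⁻¹} = χ_X`. [cite: Rogawski1990, §3.1 p. 19] -/
theorem charpoly_conj (g : ↥(unitaryGroupOfForm σ J)) (X : Matrix (Fin 3) (Fin 3) K) :
    (((g : GL (Fin 3) K) : Matrix (Fin 3) (Fin 3) K) * X * (((g : GL (Fin 3) K)⁻¹ : GL (Fin 3) K) : Matrix (Fin 3) (Fin 3) K)).charpoly = X.charpoly :=
  K2E3HC14EllLocalToUniform.charpoly_conjAct σ g X

/-- `𝔲(σ,J)` is `Ad(U)`-stable. [cite: HarishChandra1970, Part V §1 p. 40] -/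
theorem mem_lieU_conj (g : ↥(unitaryGroupOfForm σ J)) {X : Matrix (Fin 3) (Fin 3) K} (hX : (X.map σ).transpose * J + J * X = 0) :
    ((((g : GL (Fin 3) K) : Matrix (Fin 3) (Fin 3) K) * X * (((g : GL (Fin 3) K)⁻¹ : GL (Fin 3) K) : Matrix (Fin 3) (Fin 3) K)).map σ).transpose * J +
      J * (((g : GL (Fin 3) K) : Matrix (Fin 3) (Fin 3) K) * X * (((g : GL (Fin 3) K)⁻¹ : GL (Fin 3) K) : Matrix (Fin 3) (Fin 3) K)) = 0 :=
  K2E3HC14EllLocalToUniform.mem_lieU_conjAct σ g hX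

/-- Scalars commute with the action: `g (tX) g⁻¹ = t (gXg⁻¹)`. [cite: HarishChandra1970, Part VI §7 p. 59] -/
theorem conj_smul (g : ↥(unitaryGroupOfForm σ J)) (t : K) (X : Matrix (Fin 3) (Fin 3) K) :
    ((g : GL (Fin 3) K) : Matrix (Fin 3) (Fin 3) K) * (t • X) * (((g : GL (Fin 3) K)⁻¹ : GL (Fin 3) K) : Matrix (Fin 3) (Fin 3) K) =
      t • (((g : GL (Fin 3) K) : Matrix (Fin 3) (Fin 3) K) * X * (((g : GL (Fin 3) K)⁻¹ : GL (Fin 3) K) : Matrix (Fin 3) (Fin 3) K)) := by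
  rw [Matrix.mul_smul, Matrix.smul_mul]

/-- `𝔲(σ,J)` is stable under `σ`-FIXED scalars: `(σ(tX))ᵀ J + J (tX) = t((σX)ᵀJ + JX)`. [cite: HarishChandra1970, Part VI §7 p. 59] -/
theorem smul_mem_lieU {t : K} (ht : σ t = t) {X : Matrix (Fin 3) (Fin 3) K} (hX : (X.map σ).transpose * J + J * X = 0) :
    ((t • X).map σ).transpose * J + J * (t • X) = 0 := by
  have hmap : (t • X).map σ = t • X.map σ := by
    ext i j
    simp [Matrix.map_apply, ht]
  rw [hmap, Matrix.transpose_smul, Matrix.smul_mul, Matrix.mul_smul, ← smul_add, hX, smul_zero]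

/-- The centraliser set is unchanged by a non-zero scalar: `{g | g(tX)g⁻¹ = tX} = {g | gXg⁻¹ = X}`. [cite: HarishChandra1970, Part VI §7 p. 59] -/
theorem centralizerSet_smul {t : K} (ht : t ≠ 0) (X : Matrix (Fin 3) (Fin 3) K) :
    {g : ↥(unitaryGroupOfForm σ J) |
        ((g : GL (Fin 3) K) : Matrix (Fin 3) (Fin 3) K) * (t • X) * (((g : GL (Fin 3) K)⁻¹ : GL (Fin 3) K) : Matrix (Fin 3) (Fin 3) K) = t • X} =
      {g : ↥(unitaryGroupOfForm σ J) |
        ((g : GL (Fin 3) K) : Matrix (Fin 3) (Fin 3) K) * X * (((g : GL (Fin 3) K)⁻¹ : GL (Fin 3) K) : Matrix (Fin 3) (Fin 3) K) = X} := by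
  ext g
  simp only [Set.mem_setOf_eq, conj_smul]
  exact (smul_right_injective (Matrix (Fin 3) (Fin 3) K) ht).eq_iff

end Adjoint

/-! ## §3 The scalar `p` and the boxes `M₃(𝔭^k)` of the local field -/

section Boxes

variable {K : Type*} [Field K] [Valued K ℤᵐ⁰] [ValuativeRel K] [IsNonarchimedeanLocalField K]

open scoped ValuativeRel in
/-- **The residue characteristic is a small non-zero scalar**: in a non-archimedean local field of characteristic `0` the natural number
`p = char 𝓀` satisfies `p ≠ 0` and `|p|_K < 1` (`p ∈ 𝓂` because its residue vanishes).  It is fixed by every ring endomorphism `σ`,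
which is why it serves as Harish-Chandra's stretching scalar `t` on `𝔲(σ, J)`. [cite: HarishChandra1970, Part VI §7 p. 59] -/
theorem exists_natCast_normAbs_lt_one [CharZero K] : ∃ p : ℕ, (p : K) ≠ 0 ∧ normAbs K (p : K) < 1 := by
  refine ⟨ringChar 𝓀[K], Nat.cast_ne_zero.2 (CharP.ringChar_ne_zero_of_finite 𝓀[K]), ?_⟩
  have h : ((ringChar 𝓀[K] : 𝒪[K]) : K) = (ringChar 𝓀[K] : K) := by norm_cast
  rw [← h]
  refine normAbs_lt_one_iff_mem_maximalIdeal.2 ?_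
  rw [← IsLocalRing.residue_eq_zero_iff, map_natCast]
  exact ringChar.Nat.cast_ringChar

/-- `|p⁻¹|_K > 1` for the stretching scalar. [cite: HarishChandra1970, Part VI §7 p. 59] -/
theorem one_lt_normAbs_inv {a : K} (ha0 : a ≠ 0) (ha1 : normAbs K a < 1) : 1 < normAbs K a⁻¹ := by
  rw [map_inv₀]
  exact one_lt_inv_iff₀.2 ⟨pos_iff_ne_zero.2 ((_root_.map_ne_zero _).2 ha0), ha1⟩

/-- The box `M₃(𝔭^k) = {Y | ∀ i j, Y i j ∈ 𝔭^k}` is compact (★ `isCompact_setOf_forall_mem_primePowBall`). [cite: WeilBNT1967, I §2] -/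
theorem isCompact_box (k : ℤ) : IsCompact {Y : Matrix (Fin 3) (Fin 3) K | ∀ i j, Y i j ∈ primePowBall K k} :=
  Literature.MeasureTheory.Group.isCompact_setOf_forall_mem_primePowBall k

/-- The box `M₃(𝔭^k)` is open (★ `isOpen_setOf_forall_mem_primePowBall`). [cite: WeilBNT1967, I §2] -/
theorem isOpen_box (k : ℤ) : IsOpen {Y : Matrix (Fin 3) (Fin 3) K | ∀ i j, Y i j ∈ primePowBall K k} :=
  Literature.MeasureTheory.Group.isOpen_setOf_forall_mem_primePowBall k

/-- `0 ∈ M₃(𝔭^k)`. [cite: WeilBNT1967, I §2] -/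
theorem zero_mem_box (k : ℤ) : (0 : Matrix (Fin 3) (Fin 3) K) ∈ {Y : Matrix (Fin 3) (Fin 3) K | ∀ i j, Y i j ∈ primePowBall K k} :=
  fun _ _ => by simpa only [Matrix.zero_apply] using zero_mem_primePowBall k

/-- **Dilating a box**: if `|a|_K = (q⁻¹)^e` then `a • Y ∈ M₃(𝔭^k) ↔ Y ∈ M₃(𝔭^{k−e})` (★ `mul_mem_primePowBall_iff` entrywise). [cite: WeilBNT1967, I §2] -/
theorem smul_mem_box_iff {a : K} {e : ℤ} (he : normAbs K a = ((residueFieldCard K : ℝ≥0)⁻¹) ^ e) (k : ℤ) (Y : Matrix (Fin 3) (Fin 3) K) :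
    a • Y ∈ {Y : Matrix (Fin 3) (Fin 3) K | ∀ i j, Y i j ∈ primePowBall K k} ↔
      Y ∈ {Y : Matrix (Fin 3) (Fin 3) K | ∀ i j, Y i j ∈ primePowBall K (k - e)} := by
  simp only [Set.mem_setOf_eq, Matrix.smul_apply, smul_eq_mul, mul_mem_primePowBall_iff he]

/-- A scalar of absolute value `≤ 1` preserves every box. [cite: WeilBNT1967, I §2] -/
theorem smul_mem_box {a : K} (ha : normAbs K a ≤ 1) {k : ℤ} {Y : Matrix (Fin 3) (Fin 3) K}
    (hY : Y ∈ {Y : Matrix (Fin 3) (Fin 3) K | ∀ i j, Y i j ∈ primePowBall K k}) :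
    a • Y ∈ {Y : Matrix (Fin 3) (Fin 3) K | ∀ i j, Y i j ∈ primePowBall K k} := by
  intro i j
  have h := hY i j
  rw [mem_primePowBall_iff] at h ⊢
  rw [Matrix.smul_apply, smul_eq_mul, map_mul]
  exact (mul_le_of_le_one_left zero_le ha).trans h

/-- **Every compact set of matrices lies in a box** (the open boxes `M₃(𝔭^{-n})`, `n ∈ ℕ`, increase and cover `M₃(K)`). [cite: WeilBNT1967, I §2] -/
theorem exists_subset_box {S : Set (Matrix (Fin 3) (Fin 3) K)} (hS : IsCompact S) :
    ∃ k : ℤ, S ⊆ {Y : Matrix (Fin 3) (Fin 3) K | ∀ i j, Y i j ∈ primePowBall K k} := by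
  have hcover : S ⊆ ⋃ n : ℕ, {Y : Matrix (Fin 3) (Fin 3) K | ∀ i j, Y i j ∈ primePowBall K (-(n : ℤ))} := by
    intro Y _
    -- one exponent per entry, then the minimum
    choose m hm using fun ij : Fin 3 × Fin 3 => exists_mem_primePowBall (Y ij.1 ij.2)
    obtain ⟨n, hn⟩ : ∃ n : ℕ, ∀ ij : Fin 3 × Fin 3, -(n : ℤ) ≤ m ij := by
      refine ⟨(Finset.univ.sup fun ij : Fin 3 × Fin 3 => (m ij).natAbs), fun ij => ?_⟩
      have h1 : (m ij).natAbs ≤ Finset.univ.sup fun ij : Fin 3 × Fin 3 => (m ij).natAbs :=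
        Finset.le_sup (f := fun ij : Fin 3 × Fin 3 => (m ij).natAbs) (Finset.mem_univ ij)
      omega
    refine Set.mem_iUnion.2 ⟨n, fun i j => primePowBall_antitone (hn (i, j)) (hm (i, j))⟩
  have hdir : Directed (· ⊆ ·) fun n : ℕ => {Y : Matrix (Fin 3) (Fin 3) K | ∀ i j, Y i j ∈ primePowBall K (-(n : ℤ))} := by
    refine Monotone.directed_le fun n n' hnn' Y hY i j => primePowBall_antitone ?_ (hY i j)
    omega
  obtain ⟨n, hn⟩ := hS.elim_directed_cover (fun n : ℕ => {Y : Matrix (Fin 3) (Fin 3) K | ∀ i j, Y i j ∈ primePowBall K (-(n : ℤ))})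
    (fun n : ℕ => isOpen_box (-(n : ℤ))) hcover hdir
  exact ⟨-(n : ℤ), hn⟩

end Boxes

/-! ### The weight `|discr χ_X|_K^{1∕4}` under stretching -/

section Weight

variable {K : Type*} [Field K] [ValuativeRel K] [TopologicalSpace K] [IsNonarchimedeanLocalField K]

/-- **The weight under stretching**: `|discr χ_{tX}|_K^{1∕4} = (|t|_K⁶)^{1∕4} · |discr χ_X|_K^{1∕4}` (print: `|η(t⁻¹H)|^{1∕2} = |t|^{-(n-ℓ)∕2}|η(H)|^{1∕2}`,
`n − ℓ = 6`). [cite: HarishChandra1970, Part VI §7 p. 59] -/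
theorem weight_smul (t : K) (X : Matrix (Fin 3) (Fin 3) K) :
    ((normAbs K (t • X).charpoly.discr : ℝ≥0) : ℝ≥0∞) ^ (1 / 4 : ℝ) =
      (((normAbs K t ^ 6) ^ (1 / 4 : ℝ) : ℝ≥0) : ℝ≥0∞) * ((normAbs K X.charpoly.discr : ℝ≥0) : ℝ≥0∞) ^ (1 / 4 : ℝ) := by
  rw [charpoly_discr_smul, map_mul, map_pow, ENNReal.coe_mul,
    ENNReal.mul_rpow_of_nonneg _ _ (by norm_num : (0 : ℝ) ≤ 1 / 4), ENNReal.coe_rpow_of_nonneg _ (by norm_num : (0 : ℝ) ≤ 1 / 4)]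

end Weight


/-! ## §4 Orbital integrals `Φ(Θ, X) = ∫_U Θ(gXg⁻¹) dμ(g)`: measurability, the weight `|discr χ_X|_K^{1∕4}` under stretching -/

section Orbital

variable {K : Type*} [Field K] [Valued K ℤᵐ⁰] [ValuativeRel K] [IsNonarchimedeanLocalField K]
  (σ : K →+* K) {J : Matrix (Fin 3) (Fin 3) K}

omit [ValuativeRel K] [IsNonarchimedeanLocalField K] in
/-- `g ↦ gXg⁻¹` is continuous on `U`. [cite: HarishChandra1970, Part V §1 p. 40] -/
theorem continuous_conj (X : Matrix (Fin 3) (Fin 3) K) :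
    Continuous fun g : ↥(unitaryGroupOfForm σ J) =>
      ((g : GL (Fin 3) K) : Matrix (Fin 3) (Fin 3) K) * X * (((g : GL (Fin 3) K)⁻¹ : GL (Fin 3) K) : Matrix (Fin 3) (Fin 3) K) := by
  have hc1 : Continuous fun g : ↥(unitaryGroupOfForm σ J) => ((g : GL (Fin 3) K) : Matrix (Fin 3) (Fin 3) K) :=
    Units.continuous_val.comp continuous_subtype_val
  have hc2 : Continuous fun g : ↥(unitaryGroupOfForm σ J) => (((g : GL (Fin 3) K)⁻¹ : GL (Fin 3) K) : Matrix (Fin 3) (Fin 3) K) :=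
    Units.continuous_coe_inv.comp continuous_subtype_val
  exact (hc1.mul continuous_const).mul hc2

variable [MeasurableSpace ↥(unitaryGroupOfForm σ J)] [BorelSpace ↥(unitaryGroupOfForm σ J)]
  [MeasurableSpace (Matrix (Fin 3) (Fin 3) K)] [BorelSpace (Matrix (Fin 3) (Fin 3) K)]

omit [ValuativeRel K] [IsNonarchimedeanLocalField K] in
/-- `g ↦ Θ(gXg⁻¹)` is measurable for Borel `Θ`. [cite: HarishChandra1970, Part V §1 p. 40] -/
theorem measurable_comp_conj {Θ : Matrix (Fin 3) (Fin 3) K → ℝ≥0∞} (hΘ : Measurable Θ) (X : Matrix (Fin 3) (Fin 3) K) :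
    Measurable fun g : ↥(unitaryGroupOfForm σ J) =>
      Θ (((g : GL (Fin 3) K) : Matrix (Fin 3) (Fin 3) K) * X * (((g : GL (Fin 3) K)⁻¹ : GL (Fin 3) K) : Matrix (Fin 3) (Fin 3) K)) :=
  hΘ.comp (continuous_conj σ X).measurable

end Orbital

/-! ## §5 Far out: the orbit of `p^{-m} X` (`X` with `discr χ_X ≠ 0`) leaves every box (Cor. of Lemma 28) -/

section FarOut

variable {K : Type*} [Field K] [Valued K ℤᵐ⁰] [ValuativeRel K] [IsNonarchimedeanLocalField K]

/-- The invariant polynomials `coeff_d χ_Y` are bounded on the compact box `M₃(𝔭^k)`. [cite: HarishChandra1970, Part VI §1 Lemma 28 p. 48] -/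
theorem exists_bound_normAbs_charpoly_coeff (k : ℤ) (d : ℕ) :
    ∃ ρ : ℝ≥0, ∀ Y ∈ {Y : Matrix (Fin 3) (Fin 3) K | ∀ i j, Y i j ∈ primePowBall K k}, normAbs K (Y.charpoly.coeff d) ≤ ρ := by
  have hc : Continuous fun Y : Matrix (Fin 3) (Fin 3) K => normAbs K (Y.charpoly.coeff d) :=
    LocalFieldHaar.continuous_normAbs.comp (Literature.LinearAlgebra.Matrix.continuous_charpoly_coeff d)
  obtain ⟨ρ, hρ⟩ := ((isCompact_box k).image hc).bddAbove
  exact ⟨ρ, fun Y hY => hρ (Set.mem_image_of_mem _ hY)⟩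

/-- **One invariant coefficient suffices**: if `coeff_d χ_X ≠ 0` and `coeff_d` is homogeneous of degree `n ≥ 1`, then for `m ≫ 0` no matrix
of the box `M₃(𝔭^k)` has the characteristic polynomial of `p^{-m} X` (`|coeff_d χ_{p^{-m}X}| = |p|^{-mn}|coeff_d χ_X| → ∞`, while `coeff_d` is
bounded on the box). [cite: HarishChandra1970, Part VI §1 Lemma 28 and Corollary p. 48] -/
theorem exists_pow_smul_charpoly_ne (k : ℤ) {a : K} (ha0 : a ≠ 0) (ha1 : normAbs K a < 1) {d n : ℕ} (hn : n ≠ 0)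
    (hhom : ∀ (t : K) (Y : Matrix (Fin 3) (Fin 3) K), (t • Y).charpoly.coeff d = t ^ n * Y.charpoly.coeff d)
    {X : Matrix (Fin 3) (Fin 3) K} (hX : X.charpoly.coeff d ≠ 0) :
    ∃ m : ℕ, ∀ Y ∈ {Y : Matrix (Fin 3) (Fin 3) K | ∀ i j, Y i j ∈ primePowBall K k}, Y.charpoly ≠ ((a⁻¹) ^ m • X).charpoly := by
  obtain ⟨ρ, hρ⟩ := exists_bound_normAbs_charpoly_coeff (K := K) k d
  have hb1 : 1 < normAbs K a⁻¹ := one_lt_normAbs_inv ha0 ha1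
  have hv : 0 < normAbs K (X.charpoly.coeff d) := pos_iff_ne_zero.2 ((_root_.map_ne_zero _).2 hX)
  obtain ⟨m, hm⟩ := pow_unbounded_of_one_lt (ρ / normAbs K (X.charpoly.coeff d)) hb1
  refine ⟨m, fun Y hY hYX => ?_⟩
  have h1 : normAbs K (Y.charpoly.coeff d) ≤ ρ := hρ Y hY
  have h2 : normAbs K (((a⁻¹) ^ m • X).charpoly.coeff d) = (normAbs K a⁻¹ ^ m) ^ n * normAbs K (X.charpoly.coeff d) := by
    rw [hhom, map_mul, map_pow, map_pow]
  have h3 : normAbs K a⁻¹ ^ m ≤ (normAbs K a⁻¹ ^ m) ^ n := le_self_pow₀ (one_le_pow₀ hb1.le) hn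
  have h4 : ρ < normAbs K a⁻¹ ^ m * normAbs K (X.charpoly.coeff d) := (div_lt_iff₀ hv).1 hm
  rw [hYX, h2] at h1
  have h5 : normAbs K a⁻¹ ^ m * normAbs K (X.charpoly.coeff d) ≤ (normAbs K a⁻¹ ^ m) ^ n * normAbs K (X.charpoly.coeff d) :=
    mul_le_mul_of_nonneg_right h3 zero_le
  exact absurd (h4.trans_le (h5.trans h1)) (lt_irrefl ρ)

/-- **FAR OUT** ([HarishChandra1970] Cor. of Lemma 28: «`Φ_f(H) = 0` for `H` outside a compact subset of `𝔞`», here along the ray `p^{-m}X`): if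
`discr χ_X ≠ 0` then for `m ≫ 0` NO `U`-conjugate of `p^{-m} X` lies in the box `M₃(𝔭^k)` — the characteristic polynomial is a conjugation
invariant and one of its coefficients blows up. [cite: HarishChandra1970, Part VI §1 Lemma 28 and Corollary p. 48; Part VI §7 p. 60] -/
theorem exists_pow_smul_forall_conj_notMem_box (σ : K →+* K) {J : Matrix (Fin 3) (Fin 3) K} (k : ℤ) {a : K} (ha0 : a ≠ 0) (ha1 : normAbs K a < 1)
    {X : Matrix (Fin 3) (Fin 3) K} (hX : X.charpoly.discr ≠ 0) :
    ∃ m : ℕ, ∀ g : ↥(unitaryGroupOfForm σ J),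
      ((g : GL (Fin 3) K) : Matrix (Fin 3) (Fin 3) K) * ((a⁻¹) ^ m • X) * (((g : GL (Fin 3) K)⁻¹ : GL (Fin 3) K) : Matrix (Fin 3) (Fin 3) K) ∉
        {Y : Matrix (Fin 3) (Fin 3) K | ∀ i j, Y i j ∈ primePowBall K k} := by
  rcases exists_charpoly_coeff_ne_zero hX with h2 | h1 | h0
  · obtain ⟨m, hm⟩ := exists_pow_smul_charpoly_ne k ha0 ha1 one_ne_zero charpoly_coeff_two_smul h2
    exact ⟨m, fun g hg => hm _ hg (charpoly_conj σ g _)⟩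
  · obtain ⟨m, hm⟩ := exists_pow_smul_charpoly_ne k ha0 ha1 two_ne_zero charpoly_coeff_one_smul h1
    exact ⟨m, fun g hg => hm _ hg (charpoly_conj σ g _)⟩
  · obtain ⟨m, hm⟩ := exists_pow_smul_charpoly_ne k ha0 ha1 three_ne_zero charpoly_coeff_zero_smul h0
    exact ⟨m, fun g hg => hm _ hg (charpoly_conj σ g _)⟩

end FarOut

end Summit.HodgeConjecture.HodgeConjecture.Cruxes.H413.K2E3HC13LieStretchingKit

end
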